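import Literature.AnabelianGeometry.EtaleTheta.ThetaCohomologyZHatLog
import Literature.AnabelianGeometry.EtaleTheta.ContH1CoeffEndo
import Literature.AnabelianGeometry.EtaleTheta.ConstantMultipleRigidityEquivarianceProofs
import HarnessLib

/-!
# [EtTh] Prop. 1.5 (ii) «F̈¹/F̈² = Ẑ·log(Ü)»: the identification FOLLOWS from «log(Ü) restricts to the standard
# isomorphism» + topology + `Ẑ`-linearity of the Galois action (proof-only)

Mochizuki, *The étale theta function and its Frobenioid-theoretic manifestations*, Publ. RIMS **45** (2009), Prop. 1.5
(ii) p. 23 (printed 249): «F̈¹/F̈² = Hom((Δ^tp_Ÿ)^ell/Δ_Θ, Δ_Θ) = Ẑ·log(Ü) … — where we write log(Ü) := ½·log(U)», (i) «the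
symbol log(U) [denotes] the standard isomorphism (Δ^tp_Y)^ell/Δ_Θ ⥲ Ẑ(1) ⥲ Δ_Θ»; proof p. 23 l. 93: «Assertions (i), (ii)
follow immediately from the definitions» [cite: MochizukiEtTh2009, Prop 1.5 (ii) p.23]. abc-iut cell, layer L2, seat
abc-iut-L2-t1 (§1 ROOT owner). PROOF-ONLY (0 `def`) companion of the root predicate `ThetaSetting.Prop15iiQuot E hC :=
∃ λ, IsStdLog λ ∧ Fdd1QuotSpec E hC λ` (`ThetaCohomologyZHatLog.lean`, census item S1-6 / G-K3-2): of its three clauses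
(a) «res_{(Δ^tp_Ÿ)^Θ} log(Ü) = [λ]», (b) «F̈¹/F̈² ⊆ End(Δ_Θ)·[λ]», (c) «⊇», the last two are PROVED from (a) —
print's «immediately from the definitions» — given:
* the TOPOLOGY print works in: `(Π^tp_X)^Θ` Hausdorff and `(Δ^tp_Ÿ)^Θ` compact («exact sequence of abelian profinite
  groups», p. 12; census S1-1 `HasThetaTopology` gives the former) — so that the standard map `λ : (Δ^tp_Ÿ)^Θ ↠ Δ_Θ`
  is a topological quotient map and the endomorphism `e` with `res d = e ∘ λ` is CONTINUOUS (b);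
* the `Ẑ`-LINEARITY of the conjugation action on `Δ_Θ ≅ Ẑ(1)`: continuous endomorphisms of `Δ_Θ` commute with the
  action of `(Π^tp_Ÿ)^Θ` («Δ_Θ (≅ Ẑ(1))», p. 12: `End_cont(Ẑ) = Ẑ` is commutative) — so that abc-iut-L2-t6's
  coefficient-endomorphism functoriality `ContH1.mapEndo` (ContH1CoeffEndo) produces the class `e_* log(Ü) ∈ F̈¹`
  restricting to `e ∘ λ` (c).
* `ThetaSetting.logUdd_mem_Fdd1_of_stdLog` — (a) ⇒ «log(Ü) ∈ F̈¹»;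
* `ThetaSetting.exists_endo_of_mem_Fdd1` — (a)-independent: every `d ∈ F̈¹` restricts on `(Δ^tp_Ÿ)^Θ` to `e ∘ λ`
  for a continuous endomorphism `e` of `Δ_Θ` (clause (b)), for ANY standard-iso-shaped `λ`;
* `ThetaSetting.exists_mem_Fdd1_of_endo` — clause (c) from (a) + `Ẑ`-linearity;
* `ThetaSetting.prop15iiQuot_of_stdLog` — **(a) + topology + `Ẑ`-linearity ⇒ `Prop15iiQuot E hC`**.
HONEST FRAMING: [EtTh] is refereed; nothing here bears on [IUTchIII] Cor. 3.12; typed ≠ proved; no side taken.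
-/

noncomputable section

namespace Literature.AnabelianGeometry.EtaleTheta

open Literature.AnabelianGeometry.SemiGraphs Topology
open scoped IsMulCommutative

namespace ThetaSetting

variable {p : ℕ} [Fact p.Prime] {D : ThetaSetting p}

/-- **(a) ⇒ «log(Ü) ∈ F̈¹»**: if `log(Ü)` restricts on `(Δ^tp_Ÿ)^Θ` to the class of a standard map `λ` (kernel `Δ_Θ`),
it restricts trivially to `Δ_Θ`. [cite: MochizukiEtTh2009, Prop 1.5 (ii) p.23] -/
theorem logUdd_mem_Fdd1_of_stdLog (hC : D.Compat) {E : D.KummerData}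
    {lam : ↥((D.DtpYddN 1).map D.toTheta) →ₜ* D.DeltaTheta} (hstd : IsStdLog lam)
    (hres : ContH1.res (MonoidHom.id D.GtpTheta) D.DeltaTheta D.map_toTheta_DtpYddN_one_le E.logUdd =
      homClass dtpYddTheta_le_deltaTheta_map lam) :
    E.logUdd ∈ Fdd1 hC := by
  have h12 : D.DeltaTheta ≤ (D.DtpYddN 1).map D.toTheta := hC.deltaTheta_le_DtpYddTheta
  have key := ContH1.res_res (φ := MonoidHom.id D.GtpTheta) (A := D.DeltaTheta) h12
    (D.map_toTheta_DtpYddN_one_le) E.logUdd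
  have h1 : homClass (h12.trans dtpYddTheta_le_deltaTheta_map) (lam.comp (inclCMH h12)) = 1 :=
    (homClass_eq_one_iff _ _).mpr fun t => (hstd.ker_iff _).mpr t.2
  rw [hres, res_homClass, h1] at key
  exact key.symm

/-- **Clause (b) is automatic**: for ANY continuous `λ : (Δ^tp_Ÿ)^Θ ↠ Δ_Θ` with kernel `Δ_Θ` (`IsStdLog`), every class
`d ∈ F̈¹` restricts on `(Δ^tp_Ÿ)^Θ` to `e ∘ λ` for a CONTINUOUS endomorphism `e` of `Δ_Θ` — the restricted cocycle is a
continuous homomorphism killing `Δ_Θ = Ker λ` (trivial action on the central `Δ_Θ`; `d ∈ F̈¹`), and `λ` is a quotient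
map (`(Δ^tp_Ÿ)^Θ` compact, `Δ_Θ` Hausdorff). «F̈¹/F̈² = Hom((Δ^tp_Ÿ)^ell, Δ_Θ)», p. 23.
[cite: MochizukiEtTh2009, Prop 1.5 (ii) p.23] -/
theorem exists_endo_of_mem_Fdd1 (hC : D.Compat) [T2Space D.GtpTheta]
    (hcpt : IsCompact ((((D.DtpYddN 1).map D.toTheta : Subgroup D.GtpTheta)) : Set D.GtpTheta))
    {lam : ↥((D.DtpYddN 1).map D.toTheta) →ₜ* D.DeltaTheta} (hstd : IsStdLog lam)
    {d : D.H1Theta (D.GtpYdd.map D.toTheta)} (hd : d ∈ Fdd1 hC) :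
    ∃ e : D.DeltaTheta →ₜ* D.DeltaTheta,
      ContH1.res (MonoidHom.id D.GtpTheta) D.DeltaTheta D.map_toTheta_DtpYddN_one_le d =
        homClass dtpYddTheta_le_deltaTheta_map (e.comp lam) := by
  obtain ⟨f, rfl⟩ := QuotientGroup.mk_surjective d
  -- the restricted cocycle as a function on `(Δ^tp_Ÿ)^Θ`
  set g : ↥((D.DtpYddN 1).map D.toTheta) → D.DeltaTheta :=
    fun h => f.1 ⟨h.1, D.map_toTheta_DtpYddN_one_le h.2⟩ with hgdef
  have gcont : Continuous g := f.2.1.comp (continuous_subtype_val.subtype_mk _)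
  have gmul : ∀ x y, g (x * y) = g x * g y := by
    intro x y
    have h := f.2.2 ⟨x.1, D.map_toTheta_DtpYddN_one_le x.2⟩ ⟨y.1, D.map_toTheta_DtpYddN_one_le y.2⟩
    rw [MonoidHom.id_apply, conjNormal_deltaTheta_eq_self (dtpYddTheta_le_deltaTheta_map x.2)] at h
    exact h
  have gone : g 1 = 1 := by
    have h := gmul 1 1
    rwa [mul_one, left_eq_mul] at h
  let gHom : ↥((D.DtpYddN 1).map D.toTheta) →* D.DeltaTheta :=
    { toFun := g, map_one' := gone, map_mul' := gmul }
  -- `d ∈ F̈¹`: the cocycle is trivial on `Δ_Θ`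
  have hΔ : D.DeltaTheta ≤ (D.DtpYddN 1).map D.toTheta := hC.deltaTheta_le_DtpYddTheta
  have gker : ∀ h : ↥((D.DtpYddN 1).map D.toTheta), (h : D.GtpTheta) ∈ D.DeltaTheta → g h = 1 := by
    intro h hh
    have hd' : ContH1.res (MonoidHom.id D.GtpTheta) D.DeltaTheta
        (hC.deltaTheta_le_DtpYddTheta.trans (Subgroup.map_mono inf_le_left)) (QuotientGroup.mk f) = 1 := hd
    change ContH1.mk _ (ContH1.resCocycle (MonoidHom.id D.GtpTheta) D.DeltaTheta
        (hC.deltaTheta_le_DtpYddTheta.trans (Subgroup.map_mono inf_le_left)) f).2 = 1 at hd'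
    rw [ContH1.mk_eq_one_iff, mem_contCoboundaries_iff] at hd'
    obtain ⟨a, ha⟩ := hd'
    have := congrFun ha ⟨h.1, hh⟩
    rw [MonoidHom.id_apply, conjNormal_deltaTheta_eq_self (dtpYddTheta_le_deltaTheta_map (hΔ hh)),
      mul_inv_cancel] at this
    exact this
  -- factor `g` through `λ`
  have hle : lam.toMonoidHom.ker ≤ gHom.ker := by
    intro h hh
    rw [MonoidHom.mem_ker] at hh ⊢
    exact gker h ((hstd.ker_iff h).mp hh)
  let q := QuotientGroup.quotientKerEquivOfSurjective lam.toMonoidHom hstd.surjective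
  let e₀ : D.DeltaTheta →* D.DeltaTheta := (QuotientGroup.lift lam.toMonoidHom.ker gHom hle).comp q.symm.toMonoidHom
  have he₀ : ∀ h, e₀ (lam h) = g h := by
    intro h
    have hq : q.symm (lam h) = QuotientGroup.mk h := by
      apply q.injective
      rw [MulEquiv.apply_symm_apply]
      rfl
    change QuotientGroup.lift lam.toMonoidHom.ker gHom hle (q.symm (lam h)) = g h
    rw [hq]
    rfl
  -- continuity: `λ` is a quotient map (compact → Hausdorff, onto)
  haveI : CompactSpace ↥((D.DtpYddN 1).map D.toTheta) := isCompact_iff_compactSpace.mp hcpt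
  have hqm : IsQuotientMap lam :=
    (map_continuous lam).isClosedMap.isQuotientMap (map_continuous lam) hstd.surjective
  have econt : Continuous e₀ := by
    rw [hqm.continuous_iff]
    have : (e₀ : D.DeltaTheta → D.DeltaTheta) ∘ lam = g := funext fun h => he₀ h
    rw [this]
    exact gcont
  refine ⟨{ toMonoidHom := e₀, continuous_toFun := econt }, ?_⟩
  change ContH1.mk g (ContH1.resCocycle (MonoidHom.id D.GtpTheta) D.DeltaTheta D.map_toTheta_DtpYddN_one_le f).2 =
    ContH1.mk _ _
  exact ContH1.mk_congr _ (funext fun h => (he₀ h).symm) _ _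

/-- **Clause (c) from (a) + `Ẑ`-linearity**: if the continuous endomorphisms of `Δ_Θ` commute with the conjugation
action of `(Π^tp_Ÿ)^Θ` («Δ_Θ ≅ Ẑ(1)»: `End_cont(Ẑ)` is commutative), then for every `e` the class `e_* log(Ü) ∈ F̈¹`
(abc-iut-L2-t6's `ContH1.mapEndo`) restricts on `(Δ^tp_Ÿ)^Θ` to `e ∘ λ` — «Ẑ·log(Ü) ⊆ F̈¹/F̈²».
[cite: MochizukiEtTh2009, Prop 1.5 (ii) p.23] -/
theorem exists_mem_Fdd1_of_endo (hC : D.Compat) {E : D.KummerData}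
    {lam : ↥((D.DtpYddN 1).map D.toTheta) →ₜ* D.DeltaTheta} (hstd : IsStdLog lam)
    (hres : ContH1.res (MonoidHom.id D.GtpTheta) D.DeltaTheta D.map_toTheta_DtpYddN_one_le E.logUdd =
      homClass dtpYddTheta_le_deltaTheta_map lam)
    (hZ : ∀ (e : D.DeltaTheta →ₜ* D.DeltaTheta), ∀ g ∈ D.GtpYdd.map D.toTheta, ∀ a : D.DeltaTheta,
      e (MulAut.conjNormal g a) = MulAut.conjNormal g (e a))
    (e : D.DeltaTheta →ₜ* D.DeltaTheta) :
    ∃ d ∈ Fdd1 hC, ContH1.res (MonoidHom.id D.GtpTheta) D.DeltaTheta D.map_toTheta_DtpYddN_one_le d =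
      homClass dtpYddTheta_le_deltaTheta_map (e.comp lam) := by
  have hcomm : ∀ g : D.GtpTheta, g ∈ D.GtpYdd.map D.toTheta → ∀ a : D.DeltaTheta,
      e.toMonoidHom (MulAut.conjNormal ((MonoidHom.id D.GtpTheta) g) a) =
        MulAut.conjNormal ((MonoidHom.id D.GtpTheta) g) (e.toMonoidHom a) :=
    fun g hg a => hZ e g hg a
  refine ⟨ContH1.mapEndo (MonoidHom.id D.GtpTheta) D.DeltaTheta (D.GtpYdd.map D.toTheta) e.toMonoidHom
    (map_continuous e) hcomm E.logUdd, ?_, ?_⟩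
  · -- `e_* log(Ü) ∈ F̈¹`
    have hL : E.logUdd ∈ Fdd1 hC := logUdd_mem_Fdd1_of_stdLog hC hstd hres
    have key := ContH1.res_mapEndo (MonoidHom.id D.GtpTheta) D.DeltaTheta (D.GtpYdd.map D.toTheta)
      e.toMonoidHom (map_continuous e) hcomm
      (hle := hC.deltaTheta_le_DtpYddTheta.trans (D.map_toTheta_DtpYddN_one_le)) E.logUdd
    have hL' : ContH1.res (MonoidHom.id D.GtpTheta) D.DeltaTheta
        (hC.deltaTheta_le_DtpYddTheta.trans (D.map_toTheta_DtpYddN_one_le)) E.logUdd = 1 := hL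
    rw [hL', map_one] at key
    exact key
  · rw [ContH1.res_mapEndo, hres]
    change ContH1.mapEndo _ _ _ _ _ _ (ContH1.mk _ _) = ContH1.mk _ _
    rw [ContH1.mapEndo_mk]
    rfl

/-- **«F̈¹/F̈² = Ẑ·log(Ü)» from «log(Ü) restricts to the standard isomorphism»** (clause (a)) — given the printed
topology (`(Π^tp_X)^Θ` Hausdorff, `(Δ^tp_Ÿ)^Θ` compact) and the `Ẑ`-linearity of the Galois action on `Δ_Θ`: the root
predicate `Prop15iiQuot E hC` holds. Print: «Assertions (i), (ii) follow immediately from the definitions».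
[cite: MochizukiEtTh2009, Prop 1.5 (ii) p.23] -/
theorem prop15iiQuot_of_stdLog (hC : D.Compat) {E : D.KummerData} [T2Space D.GtpTheta]
    (hcpt : IsCompact ((((D.DtpYddN 1).map D.toTheta : Subgroup D.GtpTheta)) : Set D.GtpTheta))
    (hZ : ∀ (e : D.DeltaTheta →ₜ* D.DeltaTheta), ∀ g ∈ D.GtpYdd.map D.toTheta, ∀ a : D.DeltaTheta,
      e (MulAut.conjNormal g a) = MulAut.conjNormal g (e a))
    {lam : ↥((D.DtpYddN 1).map D.toTheta) →ₜ* D.DeltaTheta} (hstd : IsStdLog lam)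
    (hres : ContH1.res (MonoidHom.id D.GtpTheta) D.DeltaTheta D.map_toTheta_DtpYddN_one_le E.logUdd =
      homClass dtpYddTheta_le_deltaTheta_map lam) :
    Prop15iiQuot E hC :=
  ⟨lam, hstd, ⟨hres, fun _ hd => exists_endo_of_mem_Fdd1 hC hcpt hstd hd,
    fun e => exists_mem_Fdd1_of_endo hC hstd hres hZ e⟩⟩

end ThetaSetting

end Literature.AnabelianGeometry.EtaleTheta

end
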